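/-
Copyright (c) 2026 the pub-hodgecm-mathlib formalisation cell (harness21).  Prover seat hodgecm-mathlib-K2E3-p29 (g4), Track B ∕ R90-TF, h413 = `stmt-HodgeConjecture-24833`,
R90-TF section S8 «ContSpec-n½» (S8 dealer R90-CS-plan (g4) S8-R258 (1)): FILE 2b of the axis letters — THE ANALYTIC HEART OF [MoeglinWaldspurger1995, IV.1.11] for the `φ_ξ`-block:
OFF THE REAL AXIS, in `{1 < Re}`, the continued scattering coordinates of every `K_∞`-finite τ-admissible generator are BOUNDED near every point.  Positivity of the truncated norm in the
Maass–Selberg diagonal identity (★ p862892) on the two quarter-plane domains, the Gram form of the columns in the `L²(K_max)`-model (positive-definite: the columns are linearly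
independent on `K_max`, ★ `linearIndependent_restrict_comap_of_isChiSectionPair`), Cauchy–Schwarz for the cross scalar, and the pure four-term inequality ★ `poleControl_of_fourTerm`
(a2) (the two engine lemmas of FILE 2a ★ `R90S8ResGMidTauOffAxisGramModelU3`) give the letter `hOFFBD` of ★ p865213 — whence V2's `hPreal` (with the normal-form clause) for every generator.
-/
import Summits.HodgeConjecture.HodgeConjecture.Theorems.R90S8ResGMidTauAxisLettersOfPortsU3       -- ★ p865213 FILE 1 (this seat): `hPreal_row_of_offAxisBound`, `isClosed_of_codiscrete`, `differentiableOn_compl_of_analyticAt_off`; brings ★ p865131, V2, ★ p864973, the (L2) scalars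
import Summits.HodgeConjecture.HodgeConjecture.Theorems.R90S8ResGMidTauOffAxisGramModelU3         -- ★ FILE 2a (this seat): `bracket_le_of_chiFourTerm_offAxis` (§1 box bound), `l2Model_of_columns` (§2 the `L²(K_max)`-model); brings ★ `poleControl_of_fourTerm`
import Summits.HodgeConjecture.HodgeConjecture.Theorems.K2E1MaassSelbergSphericalBracketsCMThree    -- ★ `idelicBracket_pos` (`κ = ∫_{‖x‖≤1 ∩ 𝓕_I} ‖x‖ dν_I > 0`)
import HarnessLib

/-!
# S8 (R)′ road — `R90S8ResGMidTauOffAxisBoundOfGramU3`: OFF-AXIS BOUNDEDNESS OF THE CONTINUED SCATTERING COORDINATES [MW95 IV.1.11] — the letter `hOFFBD`, hence `hPreal`, for every generator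

Track B ∕ R90-TF, crux h413 = `stmt-HodgeConjecture-24833`, route of record `HCCMUnconditional`; cell `hodgecm-mathlib`, R90-TF section S8 «ContSpec-n½ ∕ ResidualSpectrum», sub-socket (R)′
(B ED. 7 :337) via K2E2-p12 (g10)'s (R)′τ OF RECORD ★ p865056 — per-generator letter `hPreal` (:217–:232, with the normal-form clause of J-S8-AXIS (2)); ★ p865213 reduced it to `hOFFBD`;
this file PAYS `hOFFBD`.  THEOREMS ONLY (no `def`, no `instance`, no `notation`, no named-fact hypothesis, no `sorry`; default heartbeats); lane `--supports stmt-HodgeConjecture-24833 --as helper`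
(count-neutral).  CLOSES NO SOCKET.

THE MATHEMATICS ([MoeglinWaldspurger1995, IV.1.11, IV.2.3, IV.3.12 (a)]; [Langlands1976, §7]; [Arthur1980TraceFormulaII, §4]; [BernsteinLapid2019, Thm 2.3, §4]).  Fix a τ-admissible generator `φ`, a
package `(ν, 𝓕)`, column data `(ι, φ', qv, qcv, Pv)` with the exports' clauses, and a Maass–Selberg frame `(μK, νI, 𝓕I)`.  As in ★ p865213: the exports-with-(E6) row gives `Ec`, a closed
co-discrete `P₆` and the truncated family `Fam` at `T = 1`; ★ `exists_scalars_of_coords_global` gives the continued scalars `wc`, `Bc` off `Pv` with their tube agreements and CLOSED FORMULAS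
`wc z = (Σ_j qcv_j(z)·⟨φ'_j, φ⟩_K)·I_χ`, `Bc z z = κ·Σ_{j,l} qcv_j(z) conj qcv_l(z)·⟨φ'_j, φ'_l⟩_K` (`κ = ∫ ‖x‖ dν_I > 0`, ★ `idelicBracket_pos`; `|I_χ| ≤ κ`).  In the `L²(K_max, μ_K)`-MODEL
(§2: the classes `bK_j`, `φK` of the bounded continuous columns and of `φ`), `ψ(z) := Σ_j qcv_j(z)•bK_j` has `Bc z z = κ‖ψ(z)‖²` (sesquilinearity — so the fourth bracket is REAL and `≥ 0`),
`wc z = ⟨φK, ψ(z)⟩·I_χ` (so `‖wc z‖² ≤ (κ‖φK‖²)(κ‖ψ z‖²)`, Cauchy–Schwarz), and `‖qcv_j(z)‖ ≤ C₀‖ψ(z)‖` (the `bK_j` are linearly independent — a vanishing combination is a.e., hence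
everywhere, zero on `K_max` by continuity and the Haar measure's full support, and the columns are independent on `K_max`; ★ `exists_norm_apply_le_norm_sum_smul`).  On the quarter domains
`D^± ∖ (P₆ ∪ Pv)` the diagonal identity ★ `normSq_family_eq_chiFourTerm_of_tube` (upper; ★ `…_lower_of_tube` at `conj z`) reads
`‖Fam z‖² = Cμ·CK·(T^{2x}∕(2x)·a + [T^{2iy}·conj wc − T^{−2iy}·wc]∕(2iy) − T^{−2x}∕(2x)·κ‖ψ z‖²)`, `x = Re z − 1 > 0`, `y = Im z ≠ 0`, `a = κ‖φK‖²`; the pure inequality ★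
`poleControl_of_fourTerm` (a2) bounds `κ‖ψ z‖²` on every box `Re z − 1 ∈ [x₁, x₂]`, `|Im z| ≥ η > 0` by a constant in `(x₂, η, a, T)` (§1; the degenerate `a = 0` forces `wc = 0` and then
`‖ψ z‖ = 0`).  A punctured neighbourhood of an off-axis `z₀ ∈ {1 < Re}` lies in such a box inside `D^+ ∖ P ∪ D^− ∖ P` (★ `eventually_mem_quarterDomains_of_codiscrete`), so every `qcv_j` is
bounded there: `hOFFBD` (§3), and with the normal-form clause `hPreal` (★ p865213 `hPreal_row_of_offAxisBound`).
* ENGINE (FILE 2a ★ `R90S8ResGMidTauOffAxisGramModelU3`, this seat): §1 (pure) `bracket_le_of_chiFourTerm_offAxis` — the box bound on the fourth bracket from the diagonal identity at one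
  off-axis point; §2 `l2Model_of_columns` — the `L²(K_max)`-model (realness∕non-negativity of the Gram form, Cauchy–Schwarz for the cross scalar, norm domination of the coordinates).
* §3 HEADS **`hOFFBD_of_truncatedExportsRow (μK νI h𝓕I) (hμu) (hquad) (hTEXP6)`**, **`hOFFBD_of_ports (μK νI h𝓕I) (hμu) (hquad) (hCO′)`** ⊢ ★ p865213's letter `hOFFBD` BYTE FOR BYTE;
  **`hPreal_row_of_truncatedExportsRow`**, **`hPreal_row_of_ports`** ⊢ V2's `hPreal` (:217–:232 + the NF clause) for EVERY `K_∞`-finite τ-admissible generator.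
VISIBLE: (F) `μ νG β hβ μZ hμZ` + Borel structures, (F′) `μa μf` (ports), (F″) a Maass–Selberg frame `μK νI 𝓕I` (any Haar measures, any idele-class domain — the conclusion does not
depend on them), (U) `hμu`, (Q) `hquad`, (L′) `hCO′` (resp. `hTEXP6`).
HONEST LABEL: HC_CM is proved only modulo the 7 printed citations (2 remaining named inputs: hLiu418 = `stmt-HodgeConjecture-24832`, h413 = `stmt-HodgeConjecture-24833`) until
rung 0 closes; (R)′τ's per-generator axis letters `hreal`, `hPreal` are now ★ modulo (F)(F′)(F″)(U)(Q)(L′) and the NF clause; (R)′ :337 stays `sorry` in B ED. 7; pays no socket; count-neutral.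

## References
* [MoeglinWaldspurger1995] C. Mœglin, J.-L. Waldspurger, *Spectral Decomposition and Eisenstein Series* (1995), IV.1.11, IV.2.3, IV.3.12 (a).
* [Langlands1976] R. P. Langlands, *On the Functional Equations Satisfied by Eisenstein Series*, LNM 544 (1976), §7.
* [Arthur1980TraceFormulaII] J. Arthur, *A trace formula for reductive groups II*, Compositio Math. 40 (1980), §4.
* [BernsteinLapid2019] J. Bernstein, E. Lapid, *On the meromorphic continuation of Eisenstein series*, J. Amer. Math. Soc. 37 (2024), Thm 2.3, §4.
* [Rudin1987] W. Rudin, *Real and Complex Analysis* (3rd ed., 1987), Thm. 10.20 (Riemann's removable singularity theorem).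
-/

set_option autoImplicit false
set_option linter.dupNamespace false  -- the mandated namespace `…HodgeConjecture.HodgeConjecture.R90.S8` (LEAD #1 L1) repeats the summit's segment

noncomputable section

open MeasureTheory Measure NumberField IsDedekindDomain Set Filter Topology ContRepresentation Complex
open scoped ENNReal NNReal ComplexConjugate InnerProductSpace Topology
open Literature.NumberTheory Literature.NumberTheory.Automorphic Literature.NumberTheory.Automorphic.UnitaryGroup Literature.NumberTheory.GaloisRepresentations AdelicGroupData
open Literature.NumberTheory.Automorphic.Arthur2013.Leaves.TECR Literature.NumberTheory.Rogawski1990 Literature.NumberTheory.LFunctions Literature.MeasureTheory.Group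
open Summit.HodgeConjecture.HodgeConjecture.Cruxes.H413.K2E1BorelEisensteinU Summit.HodgeConjecture.HodgeConjecture.Cruxes.H413.K2E1CharacterEisensteinU2Defs
open Summit.HodgeConjecture.HodgeConjecture.Cruxes.H413.K2E1CharacterEisensteinU3PairDefs Summit.HodgeConjecture.HodgeConjecture.Cruxes.H413.K2E1ChiSectionSpaceU3PairDefs
open Summit.HodgeConjecture.HodgeConjecture.Cruxes.H413.K2E1BLBorelSpacesU2Defs Summit.HodgeConjecture.HodgeConjecture.Cruxes.H413.K2E1BLBorelOperatorsU2Defs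
open Summit.HodgeConjecture.HodgeConjecture.Cruxes.H413.R90S8ResGMidBlockScatteringOfRecordU3 (integrable_restrict_mul_conj_of_bounded)
open Summit.HodgeConjecture.HodgeConjecture.Cruxes.H413.K2E1ChiMaassSelbergOnAxisScalarsOfRecordCMThree (exists_scalars_of_coords_global)
open Summit.HodgeConjecture.HodgeConjecture.Cruxes.H413.K2E1ChiMaassSelbergDiagonalCMThree (normSq_family_eq_chiFourTerm_of_tube normSq_family_eq_chiFourTerm_lower_of_tube)
open Summit.HodgeConjecture.HodgeConjecture.Cruxes.H413.K2E1ChiEisensteinRealAxisPoleLedgerOfExportsCMThree (quarterDomains_of_codiscrete)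
open Summit.HodgeConjecture.HodgeConjecture.Cruxes.H413.K2E1ChiMaassSelbergPoleExclusionOffAxisCMThree (eventually_mem_quarterDomains_of_codiscrete)
open Summit.HodgeConjecture.HodgeConjecture.Cruxes.H413.K2E1ChiMaassSelbergTubeFreeCMThree (chiTube_threeScalars_uniform_free)
open Summit.HodgeConjecture.HodgeConjecture.Cruxes.H413.K2E1MaassSelbergSphericalBracketsCMThree (idelicBracket_pos)
open Summit.HodgeConjecture.HodgeConjecture.Cruxes.H413.K2E1ChiScatteringCoordsEulerFactorisationCMThree (linearIndependent_restrict_comap_of_isChiSectionPair)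

namespace Summit.HodgeConjecture.HodgeConjecture.R90.S8

/-! ## §3 The heads: `hOFFBD` and `hPreal` for every `K_∞`-finite τ-admissible generator (§1, §2 = FILE 2a) -/

section Row

variable (L : Type) [Field L] [NumberField L] [IsCMField L]
  [MeasurableSpace (quasiSplit (↥(maximalRealSubfield L)) L (IsCMField.complexConj L) 3).Adelic] [BorelSpace (quasiSplit (↥(maximalRealSubfield L)) L (IsCMField.complexConj L) 3).Adelic]
  [MeasurableSpace ↥(arch (↥(maximalRealSubfield L)) L (IsCMField.complexConj L) 3 ((StdForm.antidiagonal 3).over L))] [BorelSpace ↥(arch (↥(maximalRealSubfield L)) L (IsCMField.complexConj L) 3 ((StdForm.antidiagonal 3).over L))] [MeasurableSpace ↥(finAdelic (↥(maximalRealSubfield L)) L (IsCMField.complexConj L) 3 ((StdForm.antidiagonal 3).over L))] [BorelSpace ↥(finAdelic (↥(maximalRealSubfield L)) L (IsCMField.complexConj L) 3 ((StdForm.antidiagonal 3).over L))]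
  [MeasurableSpace (AdeleRing (𝓞 L) L)ˣ] [BorelSpace (AdeleRing (𝓞 L) L)ˣ]
  (μ : Measure (quasiSplit (↥(maximalRealSubfield L)) L (IsCMField.complexConj L) 3).automorphicQuotient) [(quasiSplit (↥(maximalRealSubfield L)) L (IsCMField.complexConj L) 3).IsAutomorphicMeasure μ]
  (νG : Measure (quasiSplit (↥(maximalRealSubfield L)) L (IsCMField.complexConj L) 3).Adelic) [νG.IsHaarMeasure] [νG.IsInvInvariant] [SFinite νG]
  {β : (quasiSplit (↥(maximalRealSubfield L)) L (IsCMField.complexConj L) 3).Adelic → ℝ≥0∞}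
  (hβ : IsCoveringWeight ↥((arithmeticBorel (↥(maximalRealSubfield L)) L (IsCMField.complexConj L) 3).map (quasiSplit (↥(maximalRealSubfield L)) L (IsCMField.complexConj L) 3).arithmeticSubgroup.subtype) β)
  {μZ : Measure (borelQuotient (↥(maximalRealSubfield L)) L (IsCMField.complexConj L) 3)} [SFinite μZ]
  (hμZ : ∀ f : borelQuotient (↥(maximalRealSubfield L)) L (IsCMField.complexConj L) 3 → ℝ≥0∞, Measurable f → ∫⁻ z, f z ∂μZ = ∫⁻ g, β g * f (toBorelQuotient (↥(maximalRealSubfield L)) L (IsCMField.complexConj L) 3 g) ∂νG)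
  (μa : Measure ↥(arch (↥(maximalRealSubfield L)) L (IsCMField.complexConj L) 3 ((StdForm.antidiagonal 3).over L))) [μa.IsHaarMeasure] [μa.IsMulRightInvariant]
  (μf : Measure ↥(finAdelic (↥(maximalRealSubfield L)) L (IsCMField.complexConj L) 3 ((StdForm.antidiagonal 3).over L))) [μf.IsHaarMeasure]
  -- (F″) a Maass–Selberg frame: Haar measures on `K_max` and on the ideles, an idele-class domain (the conclusions do not depend on them)
  (μK : Measure ↥((standardMaximalCompactGL 3 L).comap (adelicVal (↥(maximalRealSubfield L)) L (IsCMField.complexConj L) 3 ((StdForm.antidiagonal 3).over L)) : Subgroup (quasiSplit (↥(maximalRealSubfield L)) L (IsCMField.complexConj L) 3).Adelic)) [μK.IsHaarMeasure]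
  (νI : Measure (AdeleRing (𝓞 L) L)ˣ) [νI.IsHaarMeasure] {𝓕I : Set (AdeleRing (𝓞 L) L)ˣ} (h𝓕I : IsIdeleClassDomain L 𝓕I)
  (ξ : OneDimAutRepH L) (μω : HeckeCharacter L)

omit [MeasurableSpace ↥(arch (↥(maximalRealSubfield L)) L (IsCMField.complexConj L) 3 ((StdForm.antidiagonal 3).over L))] [BorelSpace ↥(arch (↥(maximalRealSubfield L)) L (IsCMField.complexConj L) 3 ((StdForm.antidiagonal 3).over L))] [MeasurableSpace ↥(finAdelic (↥(maximalRealSubfield L)) L (IsCMField.complexConj L) 3 ((StdForm.antidiagonal 3).over L))] [BorelSpace ↥(finAdelic (↥(maximalRealSubfield L)) L (IsCMField.complexConj L) 3 ((StdForm.antidiagonal 3).over L))] [SFinite νG] in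
include νG hβ μK νI h𝓕I in
/-- **§3.1 HEAD — `hOFFBD_of_truncatedExportsRow`**: ★ p865213's letter `hOFFBD` — OFF THE REAL AXIS, in `{1 < Re}`, the continued scattering coordinates of EVERY `K_∞`-finite τ-admissible
generator are bounded near every point — from `hμu`, `hquad`, the exports-with-(E6) τ-row `hTEXP6` (hypothesis-first) and a Maass–Selberg frame (F″).  Proof: module docstring (§1 on the
diagonal identity ★ p862892 over the quarter domains off `P₆ ∪ Pv`, the `L²(K_max)`-model §2 for the brackets). [cite: MoeglinWaldspurger1995, IV.1.11, IV.2.3, IV.3.12 (a)] [cite: Langlands1976, §7]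
[cite: Arthur1980TraceFormulaII, §4] -/
theorem hOFFBD_of_truncatedExportsRow (hμu : μω.IsUnitary)
    (hquad : ∀ x : ideleGroup ↥(maximalRealSubfield L), μω (AdeleRing.ideleBaseChange (↥(maximalRealSubfield L)) L x) = quadraticHeckeCharCM L x)
    (hTEXP6 : ∀ (U₀ : Subgroup ↥(finAdelic (↥(maximalRealSubfield L)) L (IsCMField.complexConj L) 3 ((StdForm.antidiagonal 3).over L))) (_ : IsTauLevel L U₀)
      (φ : (quasiSplit (↥(maximalRealSubfield L)) L (IsCMField.complexConj L) 3).Adelic → ℂ) (_ : φ ∈ chiSectionSpacePair (ξ.bcη⁻¹ * ξ.bcψ⁻¹ * μω) ξ.ψ (tauLevel L U₀) ((1 : ↥(tauLevel L U₀) →* ℂ) : ↥(tauLevel L U₀) → ℂ)) (_ : Continuous φ)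
      (_ : IsArchFinite L φ)
      (ν : Measure ↥(adelicUnipotent (↥(maximalRealSubfield L)) L (IsCMField.complexConj L) 3)) (_ : ν.IsHaarMeasure) (𝓕 : Set ↥(adelicUnipotent (↥(maximalRealSubfield L)) L (IsCMField.complexConj L) 3))
      (_ : IsFundamentalDomain ↥(rationalUnipotent (↥(maximalRealSubfield L)) L (IsCMField.complexConj L) 3) 𝓕 ν) (_ : IsCompact (closure 𝓕)) (_ : ν.IsInvInvariant) (_ : ν 𝓕 = 1),
      ∃ (Ec' : ℂ → (quasiSplit (↥(maximalRealSubfield L)) L (IsCMField.complexConj L) 3).Adelic → ℂ) (P : Set ℂ), IsClosed P ∧ (∀ z₀ : ℂ, ∀ᶠ s in 𝓝[≠] z₀, s ∉ P) ∧ (∀ z ∈ P, z.re ≤ 2) ∧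
        (∀ z : ℂ, 2 < z.re → Ec' z = eisensteinSeriesU (flatSectionU φ z)) ∧ (∀ g (z : ℂ), z ∉ P → AnalyticAt ℂ (fun z => Ec' z g) z) ∧
        (∀ z : ℂ, z ∉ P → Continuous (Ec' z)) ∧
        (∀ z₁ : ℂ, z₁ ∉ P → ∀ K : Set (quasiSplit (↥(maximalRealSubfield L)) L (IsCMField.complexConj L) 3).Adelic, IsCompact K → ∃ V ∈ 𝓝 z₁, ∃ M : ℝ, ∀ z ∈ V, ∀ g ∈ K, ‖Ec' z g‖ ≤ M) ∧
        (∀ T : ℝ≥0, 1 ≤ T → ∃ Fam : ℂ → Lp ℂ 2 μ, DifferentiableOn ℂ Fam Pᶜ ∧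
          ∀ z : ℂ, z ∉ P → ((Fam z : Lp ℂ 2 μ) : (quasiSplit (↥(maximalRealSubfield L)) L (IsCMField.complexConj L) 3).automorphicQuotient → ℂ) =ᵐ[μ]
            (quasiSplit (↥(maximalRealSubfield L)) L (IsCMField.complexConj L) 3).quotFun (truncation ν 𝓕 T (Ec' z)))) :
    ∀ (U₀ : Subgroup ↥(finAdelic (↥(maximalRealSubfield L)) L (IsCMField.complexConj L) 3 ((StdForm.antidiagonal 3).over L))) (_ : IsTauLevel L U₀)
      (φ : (quasiSplit (↥(maximalRealSubfield L)) L (IsCMField.complexConj L) 3).Adelic → ℂ) (_ : φ ∈ chiSectionSpacePair (ξ.bcη⁻¹ * ξ.bcψ⁻¹ * μω) ξ.ψ (tauLevel L U₀) ((1 : ↥(tauLevel L U₀) →* ℂ) : ↥(tauLevel L U₀) → ℂ)) (_ : Continuous φ)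
      (_ : IsArchFinite L φ)
      (ν : Measure ↥(adelicUnipotent (↥(maximalRealSubfield L)) L (IsCMField.complexConj L) 3)) (_ : ν.IsHaarMeasure) (𝓕 : Set ↥(adelicUnipotent (↥(maximalRealSubfield L)) L (IsCMField.complexConj L) 3))
      (_ : IsFundamentalDomain ↥(rationalUnipotent (↥(maximalRealSubfield L)) L (IsCMField.complexConj L) 3) 𝓕 ν) (_ : IsCompact (closure 𝓕)) (_ : ν.IsInvInvariant) (_ : ν 𝓕 = 1),
      ∀ (ι : Type) [Fintype ι] (φ' : ι → (quasiSplit (↥(maximalRealSubfield L)) L (IsCMField.complexConj L) 3).Adelic → ℂ) (qv qcv : ι → ℂ → ℂ) (Pv : Set ℂ),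
        LinearIndependent ℂ φ' →
        (∀ j, IsChiSectionPair (reflectChar (IsCMField.complexConj L) (ξ.bcη⁻¹ * ξ.bcψ⁻¹ * μω)) ξ.ψ (φ' j)) →
        (∀ j, Continuous (φ' j)) →
        (∀ j, ∃ C : ℝ, ∀ x, ‖φ' j x‖ ≤ C) →
        (∀ z : ℂ, 2 < z.re → (∑ j, qv j z • φ' j) = ((((ν 𝓕).toReal⁻¹ : ℝ)) : ℂ) • (fun g : (quasiSplit (↥(maximalRealSubfield L)) L (IsCMField.complexConj L) 3).Adelic => (∫ v : ↥(adelicUnipotent (↥(maximalRealSubfield L)) L (IsCMField.complexConj L) 3), flatSectionU φ z ((quasiSplit (↥(maximalRealSubfield L)) L (IsCMField.complexConj L) 3).toAdelic (weylLongU ((IsCMField.complexConj L : L ≃ₐ[↥(maximalRealSubfield L)] L) : L →+* L) (rfl : (StdForm.antidiagonal 3).over L = (StdForm.antidiagonal 3).over L)) * ((v : (quasiSplit (↥(maximalRealSubfield L)) L (IsCMField.complexConj L) 3).Adelic) * g)) ∂ν) * (((borelHeight g : ℝ) : ℂ) ^ (z - 2)))) →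
        (∀ z₀ : ℂ, ∀ᶠ s in 𝓝[≠] z₀, s ∉ Pv) →
        (∀ z ∈ Pv, z.re ≤ 2) →
        (∀ j (z : ℂ), z ∉ Pv → AnalyticAt ℂ (qcv j) z) →
        (∀ j (z : ℂ), 2 < z.re → qcv j z = qv j z) →
        (∀ j, MeromorphicNFOn (qcv j) univ) →
      ∀ z₀ : ℂ, 1 < z₀.re → z₀.im ≠ 0 → ∃ C : ℝ, ∀ᶠ z in 𝓝[≠] z₀, ∀ j, ‖qcv j z‖ ≤ C := by
  intro U₀ hU₀ φ hφV hφc hφa ν hν 𝓕 h𝓕N h𝓕c hνi hν1 ι _ φ' qv qcv Pv hli hb hφ'c hφ'bd hqφ hPvcd _hPvre hqcvP hqcvq _hNF z₀ hz₀ hz₀im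
  classical
  -- the block character, `φ` bounded, the columns bounded
  have hχ₁u : ((ξ.bcη⁻¹ * ξ.bcψ⁻¹ * μω)).IsUnitary := isUnitary_blockChar L ξ μω hμu (norm_eta_apply_eq_one L ξ) (norm_psi_apply_eq_one L ξ)
  have hρ₁ : ∀ r : ℝ≥0ˣ, ((ξ.bcη⁻¹ * ξ.bcψ⁻¹ * μω)) (posRealIdele L r) = 1 := midBlockChar_posRealIdele L ξ μω hquad
  have hφ : IsChiSectionPair (ξ.bcη⁻¹ * ξ.bcψ⁻¹ * μω) ξ.ψ φ := isChiSectionPair_of_mem hφV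
  obtain ⟨Cφ, hφC⟩ := exists_norm_le_of_isChiSectionPair L hχ₁u (norm_psi_apply_eq_one L ξ) hφ hφc
  have hCb := hφ'bd
  choose Cb hCb' using hCb
  -- (E6) at `T = 1`
  obtain ⟨Ec, P₆, hP₆c, hP₆cd, -, hE2, -, -, -, hE6⟩ := hTEXP6 U₀ hU₀ φ hφV hφc hφa ν hν 𝓕 h𝓕N h𝓕c hνi hν1
  obtain ⟨Fam, hFd, hFam⟩ := hE6 1 le_rfl
  -- (L2) the continued scalars off `Pv` (closed by co-discreteness) with their closed formulas
  have hPvc : IsClosed Pv := isClosed_of_codiscrete hPvcd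
  obtain ⟨wc, Bc, hwc, hwagree, hBc1, hBc2, hBagree, hwcf, hBcf⟩ := exists_scalars_of_coords_global L μK νI 𝓕I ν hν1 (ξ.bcη⁻¹ * ξ.bcψ⁻¹ * μω) φ φ' hqφ
    (fun j => differentiableOn_compl_of_analyticAt_off (hqcvP j)) hqcvq hPvc
    (fun j => integrable_restrict_mul_conj_of_bounded L μK (hφ'c j) hφc (hCb' j) hφC)
    (fun j l => integrable_restrict_mul_conj_of_bounded L μK (hφ'c j) (hφ'c l) (hCb' j) (hCb' l))
  -- the joint pole set `P := P₆ ∪ Pv`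
  have hPc : IsClosed (P₆ ∪ Pv) := hP₆c.union hPvc
  have hPcd : ∀ w : ℂ, ∀ᶠ s in 𝓝[≠] w, s ∉ P₆ ∪ Pv := fun w => ((hP₆cd w).and (hPvcd w)).mono fun s hs h => h.elim hs.1 hs.2
  have h6 : (P₆ ∪ Pv)ᶜ ⊆ P₆ᶜ := compl_subset_compl.2 subset_union_left
  have hv : (P₆ ∪ Pv)ᶜ ⊆ Pvᶜ := compl_subset_compl.2 subset_union_right
  -- the `L²(K_max)`-model of the columns
  obtain ⟨C₀, hC₀, hmodel⟩ := l2Model_of_columns L μK hφ'c hφ'bd (linearIndependent_restrict_comap_of_isChiSectionPair L hli hb) hφc hφC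
  -- `κ = ∫ ‖x‖ dν_I > 0`, its complex avatar, and `|I_χ| ≤ κ`
  have hκ : 0 < (∫ x in {x : (AdeleRing (𝓞 L) L)ˣ | (IdeleClassGroup.ideleNorm L x : ℝ) ≤ 1} ∩ 𝓕I, (IdeleClassGroup.ideleNorm L x : ℝ) ∂νI) := idelicBracket_pos νI h𝓕I
  have hκC : (∫ x in {x : (AdeleRing (𝓞 L) L)ˣ | (IdeleClassGroup.ideleNorm L x : ℝ) ≤ 1} ∩ 𝓕I, ((IdeleClassGroup.ideleNorm L x : ℝ) : ℂ) ∂νI) = (((∫ x in {x : (AdeleRing (𝓞 L) L)ˣ | (IdeleClassGroup.ideleNorm L x : ℝ) ≤ 1} ∩ 𝓕I, (IdeleClassGroup.ideleNorm L x : ℝ) ∂νI) : ℝ) : ℂ) := integral_ofReal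
  have hIχ : ‖(∫ x in {x : (AdeleRing (𝓞 L) L)ˣ | (IdeleClassGroup.ideleNorm L x : ℝ) ≤ 1} ∩ 𝓕I, ((IdeleClassGroup.ideleNorm L x : ℝ) : ℂ) * (((reflectChar (IsCMField.complexConj L) (ξ.bcη⁻¹ * ξ.bcψ⁻¹ * μω) x : ℂˣ) : ℂ) * conj (((ξ.bcη⁻¹ * ξ.bcψ⁻¹ * μω) x : ℂˣ) : ℂ)) ∂νI)‖ ≤ (∫ x in {x : (AdeleRing (𝓞 L) L)ˣ | (IdeleClassGroup.ideleNorm L x : ℝ) ≤ 1} ∩ 𝓕I, (IdeleClassGroup.ideleNorm L x : ℝ) ∂νI) := by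
    refine (norm_integral_le_integral_norm _).trans (le_of_eq ?_)
    refine integral_congr_ae (Eventually.of_forall fun x => ?_)
    have h1 : ‖(((reflectChar (IsCMField.complexConj L) (ξ.bcη⁻¹ * ξ.bcψ⁻¹ * μω) x : ℂˣ) : ℂ))‖ = 1 := (IsUnitary.reflectChar hχ₁u) x
    have h2 : ‖conj (((ξ.bcη⁻¹ * ξ.bcψ⁻¹ * μω) x : ℂˣ) : ℂ)‖ = 1 := by rw [Complex.norm_conj]; exact hχ₁u x
    show ‖((IdeleClassGroup.ideleNorm L x : ℝ) : ℂ) * ((((reflectChar (IsCMField.complexConj L) (ξ.bcη⁻¹ * ξ.bcψ⁻¹ * μω) x : ℂˣ) : ℂ)) * conj (((ξ.bcη⁻¹ * ξ.bcψ⁻¹ * μω) x : ℂˣ) : ℂ))‖ = (IdeleClassGroup.ideleNorm L x : ℝ)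
    rw [norm_mul, norm_mul, h1, h2, mul_one, mul_one, Complex.norm_of_nonneg (NNReal.coe_nonneg _)]
  -- the brackets of the identity in the model: `Bc z z = κ·N z` (real `≥ 0`), `‖wc z‖² ≤ a·(κ N z)`, the coordinates dominated by `N z`
  have hN0 : ∀ z : ℂ, 0 ≤ (∫ k, ‖∑ j, qcv j z * φ' j (k : (quasiSplit (↥(maximalRealSubfield L)) L (IsCMField.complexConj L) 3).Adelic)‖ ^ 2 ∂μK) := fun z => integral_nonneg fun k => sq_nonneg _
  have hBcz : ∀ z : ℂ, Bc z z = ((((∫ x in {x : (AdeleRing (𝓞 L) L)ˣ | (IdeleClassGroup.ideleNorm L x : ℝ) ≤ 1} ∩ 𝓕I, (IdeleClassGroup.ideleNorm L x : ℝ) ∂νI) * (∫ k, ‖∑ j, qcv j z * φ' j (k : (quasiSplit (↥(maximalRealSubfield L)) L (IsCMField.complexConj L) 3).Adelic)‖ ^ 2 ∂μK) : ℝ)) : ℂ) := fun z => by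
    have hmz := (hmodel (fun j => qcv j z)).1
    beta_reduce at hmz
    rw [hBcf z z, hκC, hmz]
    push_cast
    ring
  have hwcz : ∀ z : ℂ, ‖wc z‖ ^ 2 ≤ ((∫ x in {x : (AdeleRing (𝓞 L) L)ˣ | (IdeleClassGroup.ideleNorm L x : ℝ) ≤ 1} ∩ 𝓕I, (IdeleClassGroup.ideleNorm L x : ℝ) ∂νI) * (∫ k, ‖φ (k : (quasiSplit (↥(maximalRealSubfield L)) L (IsCMField.complexConj L) 3).Adelic)‖ ^ 2 ∂μK)) * ((∫ x in {x : (AdeleRing (𝓞 L) L)ˣ | (IdeleClassGroup.ideleNorm L x : ℝ) ≤ 1} ∩ 𝓕I, (IdeleClassGroup.ideleNorm L x : ℝ) ∂νI) * (∫ k, ‖∑ j, qcv j z * φ' j (k : (quasiSplit (↥(maximalRealSubfield L)) L (IsCMField.complexConj L) 3).Adelic)‖ ^ 2 ∂μK)) := fun z => by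
    have hcs := (hmodel (fun j => qcv j z)).2.2.1
    beta_reduce at hcs
    rw [hwcf z, norm_mul, mul_pow]
    have hI2 : ‖(∫ x in {x : (AdeleRing (𝓞 L) L)ˣ | (IdeleClassGroup.ideleNorm L x : ℝ) ≤ 1} ∩ 𝓕I, ((IdeleClassGroup.ideleNorm L x : ℝ) : ℂ) * (((reflectChar (IsCMField.complexConj L) (ξ.bcη⁻¹ * ξ.bcψ⁻¹ * μω) x : ℂˣ) : ℂ) * conj (((ξ.bcη⁻¹ * ξ.bcψ⁻¹ * μω) x : ℂˣ) : ℂ)) ∂νI)‖ ^ 2 ≤ (∫ x in {x : (AdeleRing (𝓞 L) L)ˣ | (IdeleClassGroup.ideleNorm L x : ℝ) ≤ 1} ∩ 𝓕I, (IdeleClassGroup.ideleNorm L x : ℝ) ∂νI) ^ 2 := pow_le_pow_left₀ (norm_nonneg _) hIχ 2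
    calc ‖∑ j, qcv j z * ∫ k, φ' j (k : (quasiSplit (↥(maximalRealSubfield L)) L (IsCMField.complexConj L) 3).Adelic) * conj (φ (k : (quasiSplit (↥(maximalRealSubfield L)) L (IsCMField.complexConj L) 3).Adelic)) ∂μK‖ ^ 2 * ‖(∫ x in {x : (AdeleRing (𝓞 L) L)ˣ | (IdeleClassGroup.ideleNorm L x : ℝ) ≤ 1} ∩ 𝓕I, ((IdeleClassGroup.ideleNorm L x : ℝ) : ℂ) * (((reflectChar (IsCMField.complexConj L) (ξ.bcη⁻¹ * ξ.bcψ⁻¹ * μω) x : ℂˣ) : ℂ) * conj (((ξ.bcη⁻¹ * ξ.bcψ⁻¹ * μω) x : ℂˣ) : ℂ)) ∂νI)‖ ^ 2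
        ≤ ((∫ k, ‖φ (k : (quasiSplit (↥(maximalRealSubfield L)) L (IsCMField.complexConj L) 3).Adelic)‖ ^ 2 ∂μK) * (∫ k, ‖∑ j, qcv j z * φ' j (k : (quasiSplit (↥(maximalRealSubfield L)) L (IsCMField.complexConj L) 3).Adelic)‖ ^ 2 ∂μK)) * (∫ x in {x : (AdeleRing (𝓞 L) L)ˣ | (IdeleClassGroup.ideleNorm L x : ℝ) ≤ 1} ∩ 𝓕I, (IdeleClassGroup.ideleNorm L x : ℝ) ∂νI) ^ 2 := mul_le_mul hcs hI2 (sq_nonneg _) (mul_nonneg (integral_nonneg fun k => sq_nonneg _) (hN0 z))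
      _ = ((∫ x in {x : (AdeleRing (𝓞 L) L)ˣ | (IdeleClassGroup.ideleNorm L x : ℝ) ≤ 1} ∩ 𝓕I, (IdeleClassGroup.ideleNorm L x : ℝ) ∂νI) * (∫ k, ‖φ (k : (quasiSplit (↥(maximalRealSubfield L)) L (IsCMField.complexConj L) 3).Adelic)‖ ^ 2 ∂μK)) * ((∫ x in {x : (AdeleRing (𝓞 L) L)ˣ | (IdeleClassGroup.ideleNorm L x : ℝ) ≤ 1} ∩ 𝓕I, (IdeleClassGroup.ideleNorm L x : ℝ) ∂νI) * (∫ k, ‖∑ j, qcv j z * φ' j (k : (quasiSplit (↥(maximalRealSubfield L)) L (IsCMField.complexConj L) 3).Adelic)‖ ^ 2 ∂μK)) := by ring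
  have hqN : ∀ (z : ℂ) (j : ι), ‖qcv j z‖ ^ 2 ≤ C₀ * (∫ k, ‖∑ j, qcv j z * φ' j (k : (quasiSplit (↥(maximalRealSubfield L)) L (IsCMField.complexConj L) 3).Adelic)‖ ^ 2 ∂μK) := fun z j => by
    have h := (hmodel (fun j => qcv j z)).2.2.2 j
    beta_reduce at h
    exact h
  have ha0 : 0 ≤ (∫ x in {x : (AdeleRing (𝓞 L) L)ˣ | (IdeleClassGroup.ideleNorm L x : ℝ) ≤ 1} ∩ 𝓕I, (IdeleClassGroup.ideleNorm L x : ℝ) ∂νI) * (∫ k, ‖φ (k : (quasiSplit (↥(maximalRealSubfield L)) L (IsCMField.complexConj L) 3).Adelic)‖ ^ 2 ∂μK) := mul_nonneg hκ.le (integral_nonneg fun k => sq_nonneg _)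
  -- the quarter domains off `P₆ ∪ Pv`, the tube identity with uniform constants, the Maass–Selberg pairing on the sub-tubes
  obtain ⟨⟨hD₁, hD₁c, hD₁sub, ⟨O₁, O₂', hO₁, hO₁ne, hO₁D, hO₂', hO₂'ne, hO₂'D, hsep⟩, -⟩, ⟨hD₂, hD₂c, hD₂sub, ⟨Q₁, Q₂', hQ₁, hQ₁ne, hQ₁D, hQ₂', hQ₂'ne, hQ₂'D, hsep₂⟩, -⟩⟩ :=
    quarterDomains_of_codiscrete hPc hPcd one_lt_two
  have hFtube : ∀ D : Set ℂ, D ⊆ (P₆ ∪ Pv)ᶜ → ∀ z ∈ D, 2 < z.re → ((Fam z : Lp ℂ 2 μ) : (quasiSplit (↥(maximalRealSubfield L)) L (IsCMField.complexConj L) 3).automorphicQuotient → ℂ) =ᵐ[μ]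
      (quasiSplit (↥(maximalRealSubfield L)) L (IsCMField.complexConj L) 3).quotFun (truncation ν 𝓕 1 (eisensteinSeriesU (flatSectionU φ z))) := fun D hD z hz hz2 => by
    rw [← hE2 z hz2]; exact hFam z (h6 (hD hz))
  have hD₁P : ((({z : ℂ | 1 < z.re} ∩ {z : ℂ | 0 < z.im}) ∩ univ) \ (P₆ ∪ Pv)) ⊆ (P₆ ∪ Pv)ᶜ := fun z hz => hz.2
  have hD₂P : ((({z : ℂ | 1 < z.re} ∩ {z : ℂ | z.im < 0}) ∩ univ) \ (P₆ ∪ Pv)) ⊆ (P₆ ∪ Pv)ᶜ := fun z hz => hz.2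
  obtain ⟨Cμ, CK, hCμ, hCK, hU⟩ := chiTube_threeScalars_uniform_free L μ νG μK νI h𝓕I ν h𝓕N hν1 h𝓕c hβ (le_refl (1 : ℝ≥0)) hχ₁u hρ₁ (norm_psi_apply_eq_one L ξ) ξ.hψ hφc hφ hφC
  have hMStube : ∀ {D : Set ℂ}, (∀ z ∈ D, 2 < z.re → ((Fam z : Lp ℂ 2 μ) : (quasiSplit (↥(maximalRealSubfield L)) L (IsCMField.complexConj L) 3).automorphicQuotient → ℂ) =ᵐ[μ] (quasiSplit (↥(maximalRealSubfield L)) L (IsCMField.complexConj L) 3).quotFun (truncation ν 𝓕 1 (eisensteinSeriesU (flatSectionU φ z)))) →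
      ∀ z ∈ D, ∀ z' ∈ D, 2 < z'.re → z'.re < z.re →
      ⟪Fam z', Fam z⟫_ℂ = ((Cμ : ℝ) : ℂ) * (((CK : ℝ) : ℂ) *
        ((((((1 : ℝ≥0) : ℝ)) : ℂ) ^ (z + conj z' - 2) / (z + conj z' - 2)) * (((((∫ x in {x : (AdeleRing (𝓞 L) L)ˣ | (IdeleClassGroup.ideleNorm L x : ℝ) ≤ 1} ∩ 𝓕I, (IdeleClassGroup.ideleNorm L x : ℝ) ∂νI) * (∫ k, ‖φ (k : (quasiSplit (↥(maximalRealSubfield L)) L (IsCMField.complexConj L) 3).Adelic)‖ ^ 2 ∂μK))) : ℝ) : ℂ)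
          + (((((1 : ℝ≥0) : ℝ)) : ℂ) ^ (z - conj z') / (z - conj z')) * conj (wc z')
          - (((((1 : ℝ≥0) : ℝ)) : ℂ) ^ (-(z - conj z')) / (z - conj z')) * wc z
          - (((((1 : ℝ≥0) : ℝ)) : ℂ) ^ (-(z + conj z' - 2)) / (z + conj z' - 2)) * Bc z z')) := by
    intro D hFt z hz z' hz' h1 h2
    rw [hU Fam hFt z hz z' hz' h1 h2, hwagree z (h1.trans h2), hwagree z' h1, hBagree z z' (h1.trans h2) h1]
  have hT0 : (0 : ℝ) < ((1 : ℝ≥0) : ℝ) := by norm_num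
  -- the box around `z₀` and the punctured neighbourhood inside the quarter domains
  obtain ⟨hD₁ev, hD₂ev⟩ := eventually_mem_quarterDomains_of_codiscrete hPcd hz₀
  have hx₁pos : 0 < (z₀.re - 1) / 2 := by linarith
  have hηpos : 0 < |z₀.im| / 2 := by positivity
  have hbox : ∀ᶠ z : ℂ in 𝓝[≠] z₀, z.re - 1 ∈ Set.Icc ((z₀.re - 1) / 2) z₀.re ∧ |z₀.im| / 2 ≤ |z.im| := by
    have h1 : ∀ᶠ z : ℂ in 𝓝 z₀, (z₀.re - 1) / 2 + 1 < z.re := (Complex.continuous_re.tendsto z₀).eventually (lt_mem_nhds (by linarith))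
    have h2 : ∀ᶠ z : ℂ in 𝓝 z₀, z.re < z₀.re + 1 := (Complex.continuous_re.tendsto z₀).eventually (gt_mem_nhds (by linarith))
    have h3 : ∀ᶠ z : ℂ in 𝓝 z₀, |z₀.im| / 2 < |z.im| :=
      ((continuous_abs.comp Complex.continuous_im).tendsto z₀).eventually (lt_mem_nhds (show |z₀.im| / 2 < |z₀.im| by linarith [abs_pos.2 hz₀im]))
    filter_upwards [mem_nhdsWithin_of_mem_nhds h1, mem_nhdsWithin_of_mem_nhds h2, mem_nhdsWithin_of_mem_nhds h3] with z hz1 hz2 hz3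
    exact ⟨⟨by linarith, by linarith⟩, hz3.le⟩
  -- the uniform bound on the box, and the final constant
  refine ⟨Real.sqrt (C₀ * ((z₀.re * ((1 : ℝ≥0) : ℝ) ^ (2 * z₀.re) * Real.sqrt ((∫ x in {x : (AdeleRing (𝓞 L) L)ˣ | (IdeleClassGroup.ideleNorm L x : ℝ) ≤ 1} ∩ 𝓕I, (IdeleClassGroup.ideleNorm L x : ℝ) ∂νI) * (∫ k, ‖φ (k : (quasiSplit (↥(maximalRealSubfield L)) L (IsCMField.complexConj L) 3).Adelic)‖ ^ 2 ∂μK)) / (|z₀.im| / 2) +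
    Real.sqrt (z₀.re ^ 2 * ((1 : ℝ≥0) : ℝ) ^ (4 * z₀.re) * ((∫ x in {x : (AdeleRing (𝓞 L) L)ˣ | (IdeleClassGroup.ideleNorm L x : ℝ) ≤ 1} ∩ 𝓕I, (IdeleClassGroup.ideleNorm L x : ℝ) ∂νI) * (∫ k, ‖φ (k : (quasiSplit (↥(maximalRealSubfield L)) L (IsCMField.complexConj L) 3).Adelic)‖ ^ 2 ∂μK)) / (|z₀.im| / 2) ^ 2 + ((∫ x in {x : (AdeleRing (𝓞 L) L)ˣ | (IdeleClassGroup.ideleNorm L x : ℝ) ≤ 1} ∩ 𝓕I, (IdeleClassGroup.ideleNorm L x : ℝ) ∂νI) * (∫ k, ‖φ (k : (quasiSplit (↥(maximalRealSubfield L)) L (IsCMField.complexConj L) 3).Adelic)‖ ^ 2 ∂μK)) * ((1 : ℝ≥0) : ℝ) ^ (4 * z₀.re))) ^ 2 / (∫ x in {x : (AdeleRing (𝓞 L) L)ˣ | (IdeleClassGroup.ideleNorm L x : ℝ) ≤ 1} ∩ 𝓕I, (IdeleClassGroup.ideleNorm L x : ℝ) ∂νI))), ?_⟩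
  filter_upwards [hD₁ev, hD₂ev, hbox] with z hzU hzL hzbox
  have hyz : z.im ≠ 0 := fun h => by
    have h' := hzbox.2; rw [h, abs_zero] at h'; linarith
  have hxz : 1 < z.re := by have h' := hzbox.1.1; linarith
  -- the fourth bracket `κ·N z` is bounded on the box (upper quarter plane directly, lower via the reflected identity at `conj z`)
  have hbz : (∫ x in {x : (AdeleRing (𝓞 L) L)ˣ | (IdeleClassGroup.ideleNorm L x : ℝ) ≤ 1} ∩ 𝓕I, (IdeleClassGroup.ideleNorm L x : ℝ) ∂νI) * (∫ k, ‖∑ j, qcv j z * φ' j (k : (quasiSplit (↥(maximalRealSubfield L)) L (IsCMField.complexConj L) 3).Adelic)‖ ^ 2 ∂μK) ≤ (z₀.re * ((1 : ℝ≥0) : ℝ) ^ (2 * z₀.re) * Real.sqrt ((∫ x in {x : (AdeleRing (𝓞 L) L)ˣ | (IdeleClassGroup.ideleNorm L x : ℝ) ≤ 1} ∩ 𝓕I, (IdeleClassGroup.ideleNorm L x : ℝ) ∂νI) * (∫ k, ‖φ (k : (quasiSplit (↥(maximalRealSubfield L)) L (IsCMField.complexConj L) 3).Adelic)‖ ^ 2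 ∂μK)) / (|z₀.im| / 2) +
      Real.sqrt (z₀.re ^ 2 * ((1 : ℝ≥0) : ℝ) ^ (4 * z₀.re) * ((∫ x in {x : (AdeleRing (𝓞 L) L)ˣ | (IdeleClassGroup.ideleNorm L x : ℝ) ≤ 1} ∩ 𝓕I, (IdeleClassGroup.ideleNorm L x : ℝ) ∂νI) * (∫ k, ‖φ (k : (quasiSplit (↥(maximalRealSubfield L)) L (IsCMField.complexConj L) 3).Adelic)‖ ^ 2 ∂μK)) / (|z₀.im| / 2) ^ 2 + ((∫ x in {x : (AdeleRing (𝓞 L) L)ˣ | (IdeleClassGroup.ideleNorm L x : ℝ) ≤ 1} ∩ 𝓕I, (IdeleClassGroup.ideleNorm L x : ℝ) ∂νI) * (∫ k, ‖φ (k : (quasiSplit (↥(maximalRealSubfield L)) L (IsCMField.complexConj L) 3).Adelic)‖ ^ 2 ∂μK)) * ((1 : ℝ≥0) : ℝ) ^ (4 * z₀.re))) ^ 2 := by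
    rcases lt_or_gt_of_ne hyz with hneg | hpos
    · -- lower half-plane: the reflected identity at `u := conj z`
      have hzD : conj (conj z) ∈ ((({z : ℂ | 1 < z.re} ∩ {z : ℂ | z.im < 0}) ∩ univ) \ (P₆ ∪ Pv)) := by
        rw [Complex.conj_conj]; exact hzL hneg
      have hid := normSq_family_eq_chiFourTerm_lower_of_tube hD₂ hD₂c hD₂sub hQ₁ hQ₁ne hQ₁D hQ₂' hQ₂'ne hQ₂'D hsep₂ Cμ CK _ hT0 (hwc.mono (hD₂P.trans hv))
        (fun z' _ => (hBc1 z').mono (hD₂P.trans hv)) (fun z _ => (hBc2 z).mono fun u hu h => hu.2 (Or.inr h)) Fam (hFd.mono (hD₂P.trans h6)) (hMStube (hFtube _ hD₂P)) hzD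
      have hB₃ : conj (wc (conj (conj z))) = conj (conj (conj (wc (conj (conj z))))) := by simp only [Complex.conj_conj]
      have hB₄ : conj (Bc (conj (conj z)) (conj (conj z))) = ((((∫ x in {x : (AdeleRing (𝓞 L) L)ˣ | (IdeleClassGroup.ideleNorm L x : ℝ) ≤ 1} ∩ 𝓕I, (IdeleClassGroup.ideleNorm L x : ℝ) ∂νI) * (∫ k, ‖∑ j, qcv j z * φ' j (k : (quasiSplit (↥(maximalRealSubfield L)) L (IsCMField.complexConj L) 3).Adelic)‖ ^ 2 ∂μK) : ℝ)) : ℂ) := by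
        rw [Complex.conj_conj, hBcz z, Complex.conj_ofReal]
      have hW : ‖conj (conj (wc (conj (conj z))))‖ ^ 2 ≤ ((∫ x in {x : (AdeleRing (𝓞 L) L)ˣ | (IdeleClassGroup.ideleNorm L x : ℝ) ≤ 1} ∩ 𝓕I, (IdeleClassGroup.ideleNorm L x : ℝ) ∂νI) * (∫ k, ‖φ (k : (quasiSplit (↥(maximalRealSubfield L)) L (IsCMField.complexConj L) 3).Adelic)‖ ^ 2 ∂μK)) * ((∫ x in {x : (AdeleRing (𝓞 L) L)ˣ | (IdeleClassGroup.ideleNorm L x : ℝ) ≤ 1} ∩ 𝓕I, (IdeleClassGroup.ideleNorm L x : ℝ) ∂νI) * (∫ k, ‖∑ j, qcv j z * φ' j (k : (quasiSplit (↥(maximalRealSubfield L)) L (IsCMField.complexConj L) 3).Adelic)‖ ^ 2 ∂μK)) := by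
        simp only [Complex.conj_conj]; exact hwcz z
      have hxI : (conj z).re - 1 ∈ Set.Icc ((z₀.re - 1) / 2) z₀.re := by rw [Complex.conj_re]; exact hzbox.1
      have hyη : |z₀.im| / 2 ≤ |(conj z).im| := by rw [Complex.conj_im, abs_neg]; exact hzbox.2
      exact bracket_le_of_chiFourTerm_offAxis hCμ hCK (by norm_num) (by rw [Complex.conj_re]; exact hxz) (by rw [Complex.conj_im]; exact neg_ne_zero.2 hyz)
        (sq_nonneg _) ha0 (mul_nonneg hκ.le (hN0 z)) hW hB₃ hB₄ hid hx₁pos hxI hηpos hyη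
    · -- upper half-plane
      have hid := normSq_family_eq_chiFourTerm_of_tube hD₁ hD₁c hD₁sub hO₁ hO₁ne hO₁D hO₂' hO₂'ne hO₂'D hsep Cμ CK _ hT0 (hwc.mono (hD₁P.trans hv))
        (fun z' _ => (hBc1 z').mono (hD₁P.trans hv)) (fun z _ => (hBc2 z).mono fun u hu h => hu.2 (Or.inr h)) Fam (hFd.mono (hD₁P.trans h6)) (hMStube (hFtube _ hD₁P)) (hzU hpos)
      have hW : ‖conj (wc z)‖ ^ 2 ≤ ((∫ x in {x : (AdeleRing (𝓞 L) L)ˣ | (IdeleClassGroup.ideleNorm L x : ℝ) ≤ 1} ∩ 𝓕I, (IdeleClassGroup.ideleNorm L x : ℝ) ∂νI) * (∫ k, ‖φ (k : (quasiSplit (↥(maximalRealSubfield L)) L (IsCMField.complexConj L) 3).Adelic)‖ ^ 2 ∂μK)) * ((∫ x in {x : (AdeleRing (𝓞 L) L)ˣ | (IdeleClassGroup.ideleNorm L x : ℝ) ≤ 1} ∩ 𝓕I, (IdeleClassGroup.ideleNorm L x : ℝ) ∂νI) * (∫ k, ‖∑ j, qcv j z * φ' j (k : (quasiSplit (↥(maximalRealSubfield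 L)) L (IsCMField.complexConj L) 3).Adelic)‖ ^ 2 ∂μK)) := by rw [Complex.norm_conj]; exact hwcz z
      exact bracket_le_of_chiFourTerm_offAxis hCμ hCK (by norm_num) hxz hyz (sq_nonneg _) ha0 (mul_nonneg hκ.le (hN0 z)) hW (Complex.conj_conj _).symm (hBcz z) hid
        hx₁pos hzbox.1 hηpos hzbox.2
  -- hence every coordinate is bounded
  intro j
  have hNle : (∫ k, ‖∑ j, qcv j z * φ' j (k : (quasiSplit (↥(maximalRealSubfield L)) L (IsCMField.complexConj L) 3).Adelic)‖ ^ 2 ∂μK) ≤ (z₀.re * ((1 : ℝ≥0) : ℝ) ^ (2 * z₀.re) * Real.sqrt ((∫ x in {x : (AdeleRing (𝓞 L) L)ˣ | (IdeleClassGroup.ideleNorm L x : ℝ) ≤ 1} ∩ 𝓕I, (IdeleClassGroup.ideleNorm L x : ℝ) ∂νI) * (∫ k, ‖φ (k : (quasiSplit (↥(maximalRealSubfield L)) L (IsCMField.complexConj L) 3).Adelic)‖ ^ 2 ∂μK)) / (|z₀.im| / 2) +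
      Real.sqrt (z₀.re ^ 2 * ((1 : ℝ≥0) : ℝ) ^ (4 * z₀.re) * ((∫ x in {x : (AdeleRing (𝓞 L) L)ˣ | (IdeleClassGroup.ideleNorm L x : ℝ) ≤ 1} ∩ 𝓕I, (IdeleClassGroup.ideleNorm L x : ℝ) ∂νI) * (∫ k, ‖φ (k : (quasiSplit (↥(maximalRealSubfield L)) L (IsCMField.complexConj L) 3).Adelic)‖ ^ 2 ∂μK)) / (|z₀.im| / 2) ^ 2 + ((∫ x in {x : (AdeleRing (𝓞 L) L)ˣ | (IdeleClassGroup.ideleNorm L x : ℝ) ≤ 1} ∩ 𝓕I, (IdeleClassGroup.ideleNorm L x : ℝ) ∂νI) * (∫ k, ‖φ (k : (quasiSplit (↥(maximalRealSubfield L)) L (IsCMField.complexConj L) 3).Adelic)‖ ^ 2 ∂μK)) * ((1 : ℝ≥0) : ℝ) ^ (4 * z₀.re))) ^ 2 / (∫ x in {x : (AdeleRing (𝓞 L) L)ˣ | (IdeleClassGroup.ideleNorm L x : ℝ) ≤ 1} ∩ 𝓕I, (IdeleClassGroup.ideleNorm L x : ℝ) ∂νI) := by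
    rw [le_div_iff₀ hκ, mul_comm]; exact hbz
  calc ‖qcv j z‖ = Real.sqrt (‖qcv j z‖ ^ 2) := (Real.sqrt_sq (norm_nonneg _)).symm
    _ ≤ _ := Real.sqrt_le_sqrt ((hqN z j).trans (mul_le_mul_of_nonneg_left hNle hC₀))

include μ νG hβ hμZ μa μf μK νI h𝓕I in
/-- **§3.2 — `hOFFBD_of_ports`**: the same letter with (E6) DISCHARGED by ★ p865131 `hTEXP6_row_of_ports` (visible: frames (F)(F′)(F″), `hμu`, `hquad`, `hCO′`).
[cite: MoeglinWaldspurger1995, IV.1.11, IV.3.12 (a)] [cite: BernsteinLapid2019, Thm 2.3, §4] -/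
theorem hOFFBD_of_ports (hμu : μω.IsUnitary)
    (hquad : ∀ x : ideleGroup ↥(maximalRealSubfield L), μω (AdeleRing.ideleBaseChange (↥(maximalRealSubfield L)) L x) = quadraticHeckeCharCM L x)
    (hCO : ∀ (W₀ : Submodule ℂ ((quasiSplit (↥(maximalRealSubfield L)) L (IsCMField.complexConj L) 3).Adelic → ℂ)) (hW₀K : ∀ k : ↥(archMaximalCompact L), ∀ ψ ∈ W₀, ((rightTranslation (quasiSplit (↥(maximalRealSubfield L)) L (IsCMField.complexConj L) 3)).comp (archMaximalCompact L).subtype) k ψ ∈ W₀) (_ : FiniteDimensional ℂ ↥W₀)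
      (_ : ∀ ψ ∈ W₀, IsChiSectionPair (ξ.bcη⁻¹ * ξ.bcψ⁻¹ * μω) ξ.ψ ψ) (_ : ∀ ψ ∈ W₀, Continuous ψ) (_ : (Subrepresentation.toRepresentation (⟨W₀, hW₀K⟩ : Subrepresentation ((rightTranslation (quasiSplit (↥(maximalRealSubfield L)) L (IsCMField.complexConj L) 3)).comp (archMaximalCompact L).subtype))).IsIrreducible),
      ∃ l₀ : ↥W₀ →ₗ[ℂ] ℂ, ∀ l : ↥W₀ →ₗ[ℂ] ℂ,
        (∀ (m : ↥(arch (↥(maximalRealSubfield L)) L (IsCMField.complexConj L) 3 ((StdForm.antidiagonal 3).over L))) (hmB : (archToAdelic (↥(maximalRealSubfield L)) L (IsCMField.complexConj L) 3 ((StdForm.antidiagonal 3).over L)) m ∈ borelAdelic (↥(maximalRealSubfield L)) L (IsCMField.complexConj L) 3) (hmK : (adelicVal (↥(maximalRealSubfield L)) L (IsCMField.complexConj L) 3 ((StdForm.antidiagonal 3).over L)) ((archToAdelic (↥(maximalRealSubfield L)) L (IsCMField.complexConj L) 3 ((StdForm.antidiagonal 3).over L)) m) ∈ standardMaximalCompactGL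 3 L) (w : ↥W₀),
          l ((Subrepresentation.toRepresentation (⟨W₀, hW₀K⟩ : Subrepresentation ((rightTranslation (quasiSplit (↥(maximalRealSubfield L)) L (IsCMField.complexConj L) 3)).comp (archMaximalCompact L).subtype))) ⟨(archToAdelic (↥(maximalRealSubfield L)) L (IsCMField.complexConj L) 3 ((StdForm.antidiagonal 3).over L)) m, archToAdelic_mem_archMaximalCompact L m hmK⟩ w) = ((((ξ.bcη⁻¹ * ξ.bcψ⁻¹ * μω)) (firstEntryUnit hmB) : ℂˣ) : ℂ) * (((ξ.ψ) (middleEntryUnitary hmB) : ℂˣ) : ℂ) * l w) →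
        ∃ a : ℂ, l = a • l₀) :
    ∀ (U₀ : Subgroup ↥(finAdelic (↥(maximalRealSubfield L)) L (IsCMField.complexConj L) 3 ((StdForm.antidiagonal 3).over L))) (_ : IsTauLevel L U₀)
      (φ : (quasiSplit (↥(maximalRealSubfield L)) L (IsCMField.complexConj L) 3).Adelic → ℂ) (_ : φ ∈ chiSectionSpacePair (ξ.bcη⁻¹ * ξ.bcψ⁻¹ * μω) ξ.ψ (tauLevel L U₀) ((1 : ↥(tauLevel L U₀) →* ℂ) : ↥(tauLevel L U₀) → ℂ)) (_ : Continuous φ)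
      (_ : IsArchFinite L φ)
      (ν : Measure ↥(adelicUnipotent (↥(maximalRealSubfield L)) L (IsCMField.complexConj L) 3)) (_ : ν.IsHaarMeasure) (𝓕 : Set ↥(adelicUnipotent (↥(maximalRealSubfield L)) L (IsCMField.complexConj L) 3))
      (_ : IsFundamentalDomain ↥(rationalUnipotent (↥(maximalRealSubfield L)) L (IsCMField.complexConj L) 3) 𝓕 ν) (_ : IsCompact (closure 𝓕)) (_ : ν.IsInvInvariant) (_ : ν 𝓕 = 1),
      ∀ (ι : Type) [Fintype ι] (φ' : ι → (quasiSplit (↥(maximalRealSubfield L)) L (IsCMField.complexConj L) 3).Adelic → ℂ) (qv qcv : ι → ℂ → ℂ) (Pv : Set ℂ),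
        LinearIndependent ℂ φ' →
        (∀ j, IsChiSectionPair (reflectChar (IsCMField.complexConj L) (ξ.bcη⁻¹ * ξ.bcψ⁻¹ * μω)) ξ.ψ (φ' j)) →
        (∀ j, Continuous (φ' j)) →
        (∀ j, ∃ C : ℝ, ∀ x, ‖φ' j x‖ ≤ C) →
        (∀ z : ℂ, 2 < z.re → (∑ j, qv j z • φ' j) = ((((ν 𝓕).toReal⁻¹ : ℝ)) : ℂ) • (fun g : (quasiSplit (↥(maximalRealSubfield L)) L (IsCMField.complexConj L) 3).Adelic => (∫ v : ↥(adelicUnipotent (↥(maximalRealSubfield L)) L (IsCMField.complexConj L) 3), flatSectionU φ z ((quasiSplit (↥(maximalRealSubfield L)) L (IsCMField.complexConj L) 3).toAdelic (weylLongU ((IsCMField.complexConj L : L ≃ₐ[↥(maximalRealSubfield L)] L) : L →+* L) (rfl : (StdForm.antidiagonal 3).over L = (StdForm.antidiagonal 3).over L)) * ((v : (quasiSplit (↥(maximalRealSubfield L)) L (IsCMField.complexConj L) 3).Adelic) * g)) ∂ν) * (((borelHeight g : ℝ) : ℂ) ^ (z - 2)))) →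
        (∀ z₀ : ℂ, ∀ᶠ s in 𝓝[≠] z₀, s ∉ Pv) →
        (∀ z ∈ Pv, z.re ≤ 2) →
        (∀ j (z : ℂ), z ∉ Pv → AnalyticAt ℂ (qcv j) z) →
        (∀ j (z : ℂ), 2 < z.re → qcv j z = qv j z) →
        (∀ j, MeromorphicNFOn (qcv j) univ) →
      ∀ z₀ : ℂ, 1 < z₀.re → z₀.im ≠ 0 → ∃ C : ℝ, ∀ᶠ z in 𝓝[≠] z₀, ∀ j, ‖qcv j z‖ ≤ C :=
  hOFFBD_of_truncatedExportsRow L μ νG hβ μK νI h𝓕I ξ μω hμu hquad (hTEXP6_row_of_ports L μ νG hβ hμZ μa μf ξ μω hμu hCO)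

omit [MeasurableSpace ↥(arch (↥(maximalRealSubfield L)) L (IsCMField.complexConj L) 3 ((StdForm.antidiagonal 3).over L))] [BorelSpace ↥(arch (↥(maximalRealSubfield L)) L (IsCMField.complexConj L) 3 ((StdForm.antidiagonal 3).over L))] [MeasurableSpace ↥(finAdelic (↥(maximalRealSubfield L)) L (IsCMField.complexConj L) 3 ((StdForm.antidiagonal 3).over L))] [BorelSpace ↥(finAdelic (↥(maximalRealSubfield L)) L (IsCMField.complexConj L) 3 ((StdForm.antidiagonal 3).over L))] [SFinite νG] in
include νG hβ μK νI h𝓕I in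
/-- **§3.3 — `hPreal_row_of_truncatedExportsRow`**: V2's per-generator OFF-AXIS POLE EXCLUSION `hPreal` (★ p865056 :217–:232, with the normal-form clause of J-S8-AXIS (2)) for EVERY
`K_∞`-finite τ-admissible generator — ★ p865213 `hPreal_row_of_offAxisBound` ∘ §3.1: NO visible per-generator letter remains. [cite: MoeglinWaldspurger1995, IV.1.11] [cite: Langlands1976, §7]
[cite: Rudin1987, Thm. 10.20] -/
theorem hPreal_row_of_truncatedExportsRow (hμu : μω.IsUnitary)
    (hquad : ∀ x : ideleGroup ↥(maximalRealSubfield L), μω (AdeleRing.ideleBaseChange (↥(maximalRealSubfield L)) L x) = quadraticHeckeCharCM L x)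
    (hTEXP6 : ∀ (U₀ : Subgroup ↥(finAdelic (↥(maximalRealSubfield L)) L (IsCMField.complexConj L) 3 ((StdForm.antidiagonal 3).over L))) (_ : IsTauLevel L U₀)
      (φ : (quasiSplit (↥(maximalRealSubfield L)) L (IsCMField.complexConj L) 3).Adelic → ℂ) (_ : φ ∈ chiSectionSpacePair (ξ.bcη⁻¹ * ξ.bcψ⁻¹ * μω) ξ.ψ (tauLevel L U₀) ((1 : ↥(tauLevel L U₀) →* ℂ) : ↥(tauLevel L U₀) → ℂ)) (_ : Continuous φ)
      (_ : IsArchFinite L φ)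
      (ν : Measure ↥(adelicUnipotent (↥(maximalRealSubfield L)) L (IsCMField.complexConj L) 3)) (_ : ν.IsHaarMeasure) (𝓕 : Set ↥(adelicUnipotent (↥(maximalRealSubfield L)) L (IsCMField.complexConj L) 3))
      (_ : IsFundamentalDomain ↥(rationalUnipotent (↥(maximalRealSubfield L)) L (IsCMField.complexConj L) 3) 𝓕 ν) (_ : IsCompact (closure 𝓕)) (_ : ν.IsInvInvariant) (_ : ν 𝓕 = 1),
      ∃ (Ec' : ℂ → (quasiSplit (↥(maximalRealSubfield L)) L (IsCMField.complexConj L) 3).Adelic → ℂ) (P : Set ℂ), IsClosed P ∧ (∀ z₀ : ℂ, ∀ᶠ s in 𝓝[≠] z₀, s ∉ P) ∧ (∀ z ∈ P, z.re ≤ 2) ∧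
        (∀ z : ℂ, 2 < z.re → Ec' z = eisensteinSeriesU (flatSectionU φ z)) ∧ (∀ g (z : ℂ), z ∉ P → AnalyticAt ℂ (fun z => Ec' z g) z) ∧
        (∀ z : ℂ, z ∉ P → Continuous (Ec' z)) ∧
        (∀ z₁ : ℂ, z₁ ∉ P → ∀ K : Set (quasiSplit (↥(maximalRealSubfield L)) L (IsCMField.complexConj L) 3).Adelic, IsCompact K → ∃ V ∈ 𝓝 z₁, ∃ M : ℝ, ∀ z ∈ V, ∀ g ∈ K, ‖Ec' z g‖ ≤ M) ∧
        (∀ T : ℝ≥0, 1 ≤ T → ∃ Fam : ℂ → Lp ℂ 2 μ, DifferentiableOn ℂ Fam Pᶜ ∧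
          ∀ z : ℂ, z ∉ P → ((Fam z : Lp ℂ 2 μ) : (quasiSplit (↥(maximalRealSubfield L)) L (IsCMField.complexConj L) 3).automorphicQuotient → ℂ) =ᵐ[μ]
            (quasiSplit (↥(maximalRealSubfield L)) L (IsCMField.complexConj L) 3).quotFun (truncation ν 𝓕 T (Ec' z)))) :
    ∀ (U₀ : Subgroup ↥(finAdelic (↥(maximalRealSubfield L)) L (IsCMField.complexConj L) 3 ((StdForm.antidiagonal 3).over L))) (_ : IsTauLevel L U₀)
      (φ : (quasiSplit (↥(maximalRealSubfield L)) L (IsCMField.complexConj L) 3).Adelic → ℂ) (_ : φ ∈ chiSectionSpacePair (ξ.bcη⁻¹ * ξ.bcψ⁻¹ * μω) ξ.ψ (tauLevel L U₀) ((1 : ↥(tauLevel L U₀) →* ℂ) : ↥(tauLevel L U₀) → ℂ)) (_ : Continuous φ)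
      (_ : IsArchFinite L φ)
      (ν : Measure ↥(adelicUnipotent (↥(maximalRealSubfield L)) L (IsCMField.complexConj L) 3)) (_ : ν.IsHaarMeasure) (𝓕 : Set ↥(adelicUnipotent (↥(maximalRealSubfield L)) L (IsCMField.complexConj L) 3))
      (_ : IsFundamentalDomain ↥(rationalUnipotent (↥(maximalRealSubfield L)) L (IsCMField.complexConj L) 3) 𝓕 ν) (_ : IsCompact (closure 𝓕)) (_ : ν.IsInvInvariant) (_ : ν 𝓕 = 1),
      ∀ (ι : Type) [Fintype ι] (φ' : ι → (quasiSplit (↥(maximalRealSubfield L)) L (IsCMField.complexConj L) 3).Adelic → ℂ) (qv qcv : ι → ℂ → ℂ) (Pv : Set ℂ),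
        LinearIndependent ℂ φ' →
        (∀ j, IsChiSectionPair (reflectChar (IsCMField.complexConj L) (ξ.bcη⁻¹ * ξ.bcψ⁻¹ * μω)) ξ.ψ (φ' j)) →
        (∀ j, Continuous (φ' j)) →
        (∀ j, ∃ C : ℝ, ∀ x, ‖φ' j x‖ ≤ C) →
        (∀ z : ℂ, 2 < z.re → (∑ j, qv j z • φ' j) = ((((ν 𝓕).toReal⁻¹ : ℝ)) : ℂ) • (fun g : (quasiSplit (↥(maximalRealSubfield L)) L (IsCMField.complexConj L) 3).Adelic => (∫ v : ↥(adelicUnipotent (↥(maximalRealSubfield L)) L (IsCMField.complexConj L) 3), flatSectionU φ z ((quasiSplit (↥(maximalRealSubfield L)) L (IsCMField.complexConj L) 3).toAdelic (weylLongU ((IsCMField.complexConj L : L ≃ₐ[↥(maximalRealSubfield L)] L) : L →+* L) (rfl : (StdForm.antidiagonal 3).over L = (StdForm.antidiagonal 3).over L)) * ((v : (quasiSplit (↥(maximalRealSubfield L)) L (IsCMField.complexConj L) 3).Adelic) * g)) ∂ν) * (((borelHeight g : ℝ) : ℂ) ^ (z - 2)))) →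
        (∀ z₀ : ℂ, ∀ᶠ s in 𝓝[≠] z₀, s ∉ Pv) →
        (∀ z ∈ Pv, z.re ≤ 2) →
        (∀ j (z : ℂ), z ∉ Pv → AnalyticAt ℂ (qcv j) z) →
        (∀ j (z : ℂ), 2 < z.re → qcv j z = qv j z) →
        (∀ j, MeromorphicNFOn (qcv j) univ) →
      ∀ j (z : ℂ), 1 < z.re → z.im ≠ 0 → AnalyticAt ℂ (qcv j) z :=
  hPreal_row_of_offAxisBound L ξ μω (hOFFBD_of_truncatedExportsRow L μ νG hβ μK νI h𝓕I ξ μω hμu hquad hTEXP6)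

include μ νG hβ hμZ μa μf μK νI h𝓕I in
/-- **§3.4 — `hPreal_row_of_ports`**: the same with (E6) discharged by the ports (visible: frames (F)(F′)(F″), `hμu`, `hquad`, `hCO′`). [cite: MoeglinWaldspurger1995, IV.1.11]
[cite: BernsteinLapid2019, Thm 2.3, §4] [cite: Rogawski1990, §13.9 p. 229 (ii)] -/
theorem hPreal_row_of_ports (hμu : μω.IsUnitary)
    (hquad : ∀ x : ideleGroup ↥(maximalRealSubfield L), μω (AdeleRing.ideleBaseChange (↥(maximalRealSubfield L)) L x) = quadraticHeckeCharCM L x)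
    (hCO : ∀ (W₀ : Submodule ℂ ((quasiSplit (↥(maximalRealSubfield L)) L (IsCMField.complexConj L) 3).Adelic → ℂ)) (hW₀K : ∀ k : ↥(archMaximalCompact L), ∀ ψ ∈ W₀, ((rightTranslation (quasiSplit (↥(maximalRealSubfield L)) L (IsCMField.complexConj L) 3)).comp (archMaximalCompact L).subtype) k ψ ∈ W₀) (_ : FiniteDimensional ℂ ↥W₀)
      (_ : ∀ ψ ∈ W₀, IsChiSectionPair (ξ.bcη⁻¹ * ξ.bcψ⁻¹ * μω) ξ.ψ ψ) (_ : ∀ ψ ∈ W₀, Continuous ψ) (_ : (Subrepresentation.toRepresentation (⟨W₀, hW₀K⟩ : Subrepresentation ((rightTranslation (quasiSplit (↥(maximalRealSubfield L)) L (IsCMField.complexConj L) 3)).comp (archMaximalCompact L).subtype))).IsIrreducible),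
      ∃ l₀ : ↥W₀ →ₗ[ℂ] ℂ, ∀ l : ↥W₀ →ₗ[ℂ] ℂ,
        (∀ (m : ↥(arch (↥(maximalRealSubfield L)) L (IsCMField.complexConj L) 3 ((StdForm.antidiagonal 3).over L))) (hmB : (archToAdelic (↥(maximalRealSubfield L)) L (IsCMField.complexConj L) 3 ((StdForm.antidiagonal 3).over L)) m ∈ borelAdelic (↥(maximalRealSubfield L)) L (IsCMField.complexConj L) 3) (hmK : (adelicVal (↥(maximalRealSubfield L)) L (IsCMField.complexConj L) 3 ((StdForm.antidiagonal 3).over L)) ((archToAdelic (↥(maximalRealSubfield L)) L (IsCMField.complexConj L) 3 ((StdForm.antidiagonal 3).over L)) m) ∈ standardMaximalCompactGL 3 L) (w : ↥W₀),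
          l ((Subrepresentation.toRepresentation (⟨W₀, hW₀K⟩ : Subrepresentation ((rightTranslation (quasiSplit (↥(maximalRealSubfield L)) L (IsCMField.complexConj L) 3)).comp (archMaximalCompact L).subtype))) ⟨(archToAdelic (↥(maximalRealSubfield L)) L (IsCMField.complexConj L) 3 ((StdForm.antidiagonal 3).over L)) m, archToAdelic_mem_archMaximalCompact L m hmK⟩ w) = ((((ξ.bcη⁻¹ * ξ.bcψ⁻¹ * μω)) (firstEntryUnit hmB) : ℂˣ) : ℂ) * (((ξ.ψ) (middleEntryUnitary hmB) : ℂˣ) : ℂ) * l w) →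
        ∃ a : ℂ, l = a • l₀) :
    ∀ (U₀ : Subgroup ↥(finAdelic (↥(maximalRealSubfield L)) L (IsCMField.complexConj L) 3 ((StdForm.antidiagonal 3).over L))) (_ : IsTauLevel L U₀)
      (φ : (quasiSplit (↥(maximalRealSubfield L)) L (IsCMField.complexConj L) 3).Adelic → ℂ) (_ : φ ∈ chiSectionSpacePair (ξ.bcη⁻¹ * ξ.bcψ⁻¹ * μω) ξ.ψ (tauLevel L U₀) ((1 : ↥(tauLevel L U₀) →* ℂ) : ↥(tauLevel L U₀) → ℂ)) (_ : Continuous φ)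
      (_ : IsArchFinite L φ)
      (ν : Measure ↥(adelicUnipotent (↥(maximalRealSubfield L)) L (IsCMField.complexConj L) 3)) (_ : ν.IsHaarMeasure) (𝓕 : Set ↥(adelicUnipotent (↥(maximalRealSubfield L)) L (IsCMField.complexConj L) 3))
      (_ : IsFundamentalDomain ↥(rationalUnipotent (↥(maximalRealSubfield L)) L (IsCMField.complexConj L) 3) 𝓕 ν) (_ : IsCompact (closure 𝓕)) (_ : ν.IsInvInvariant) (_ : ν 𝓕 = 1),
      ∀ (ι : Type) [Fintype ι] (φ' : ι → (quasiSplit (↥(maximalRealSubfield L)) L (IsCMField.complexConj L) 3).Adelic → ℂ) (qv qcv : ι → ℂ → ℂ) (Pv : Set ℂ),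
        LinearIndependent ℂ φ' →
        (∀ j, IsChiSectionPair (reflectChar (IsCMField.complexConj L) (ξ.bcη⁻¹ * ξ.bcψ⁻¹ * μω)) ξ.ψ (φ' j)) →
        (∀ j, Continuous (φ' j)) →
        (∀ j, ∃ C : ℝ, ∀ x, ‖φ' j x‖ ≤ C) →
        (∀ z : ℂ, 2 < z.re → (∑ j, qv j z • φ' j) = ((((ν 𝓕).toReal⁻¹ : ℝ)) : ℂ) • (fun g : (quasiSplit (↥(maximalRealSubfield L)) L (IsCMField.complexConj L) 3).Adelic => (∫ v : ↥(adelicUnipotent (↥(maximalRealSubfield L)) L (IsCMField.complexConj L) 3), flatSectionU φ z ((quasiSplit (↥(maximalRealSubfield L)) L (IsCMField.complexConj L) 3).toAdelic (weylLongU ((IsCMField.complexConj L : L ≃ₐ[↥(maximalRealSubfield L)] L) : L →+* L) (rfl : (StdForm.antidiagonal 3).over L = (StdForm.antidiagonal 3).over L)) * ((v : (quasiSplit (↥(maximalRealSubfield L)) L (IsCMField.complexConj L) 3).Adelic) * g)) ∂ν) * (((borelHeight g : ℝ) : ℂ) ^ (z - 2)))) →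
        (∀ z₀ : ℂ, ∀ᶠ s in 𝓝[≠] z₀, s ∉ Pv) →
        (∀ z ∈ Pv, z.re ≤ 2) →
        (∀ j (z : ℂ), z ∉ Pv → AnalyticAt ℂ (qcv j) z) →
        (∀ j (z : ℂ), 2 < z.re → qcv j z = qv j z) →
        (∀ j, MeromorphicNFOn (qcv j) univ) →
      ∀ j (z : ℂ), 1 < z.re → z.im ≠ 0 → AnalyticAt ℂ (qcv j) z :=
  hPreal_row_of_offAxisBound L ξ μω (hOFFBD_of_ports L μ νG hβ hμZ μa μf μK νI h𝓕I ξ μω hμu hquad hCO)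

end Row

end Summit.HodgeConjecture.HodgeConjecture.R90.S8

end
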